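import Literature.MathematicalPhysics.QuantumFieldTheory.Balaban1983to89.B3Op116CollarRows
import Literature.MathematicalPhysics.QuantumFieldTheory.Balaban1983to89.B3Ineq31SmoothLocalization

/-!
# Bałaban, *(Higgs)₂,₃ quantum fields in a finite volume III* [B3] — THE EXPLICIT CONSTANT OF THE COLLAR MEMBERS OF (2.5) (Route δ),
as a named function of the scale, the lattice spacing, the dictionary constants and the configuration's scalar parameters — file «CollarConst»

statement-level skeleton of published theorems with citation tags; proofs where landed; nothing here is a claim about the Yang–Mills mass gap

T. Bałaban, Commun. Math. Phys. **88** (1983) 411–445 [cite: Balaban1983Higgs3], (2.5) p. 424, (1.16) p. 414, p. 433 (class (c));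
part I [cite: Balaban1982Higgs1], Prop. 2.1 p. 610.

CITATION HEADER (lean-in-tree rule).  Cell `lit-balaban`, Phase-2 proof seat **p40** gen 78 (unit `lit-balaban-p40`,
literature-prover-lit-balaban-p40-g78-0); free-target protocol G.5-34(d) (TAKING HOME/STATUS.md 2026-08-23T19:46:47Z, the `ClassCSplit` glue; this
file is its constants companion).  Design note `lit-balaban-p40/DESIGN-B3-116-box.md` §9.  USED BY NAME: p40's `B3Op116CollarRows.{collarC,
farC, faceC, collarC_nonneg, farC_pos, faceC_nonneg}` (p365561/p366906), p33's `B3Ineq31SmoothLocalization.{smoothConst, smoothConst_pos}`.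
No head claim; cells B3.Eq2.5 / B3.Txt@433 (owner r15) — a located member's bookkeeping.

## Why this file exists

The (B)-level collar members (`B3Ineq25Op116CollarRegion.ineq25At_one_zero_collar_of_dict`, α = 0, p368762;
`B3Ineq25Op116CollarRegionHolder.ineq25At_one_zero_collar_holder_of_dict`, 0 ≤ α < 1, p371461) display their constant EXPLICITLY — a
33-line combination of `collarC`, `farC`, `faceC`, `smoothConst` in the dictionary constants `c_Y, c_Y′, …`, the charge `|e|s`, the
regularity `δ_A` of the collar part, the number of boundary faces, `a_k`, `L^kε`, `ε`.  Their (C)-level wrappers on a cell-product box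
conclude `∃ K ≥ 0, … Ineq25At … (C_G + (ε^d)^{−1}·farF(δ,ρ)·K)` with `K` quantified AFTER the configuration — convenient, but as a STATEMENT it
certifies no uniformity in the configuration.  This file NAMES the explicit combination, `collarK`, so that the (C)-level members and the
class-(c) glue can be stated with the constant given BEFORE the configuration as an explicit function of its scalar parameters
(`k`, `ε` through `P`, `s = sup|P|`, `δ_A`, the face count `n_F`), exactly like the torus/region lineage's `valC/derC/holC/mixC`.

## Honest scope

A definition (the displayed (B)-level constant, verbatim, with the face-family cardinality replaced by a natural-number parameter `n_F`) and its
nonnegativity; no estimate is proved here.  The constant is explicit but `k`- and `ε`-dependent (declared divergence from print's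
`O(1)(e(L^kε)p(L^kε))^{n+n′}`, p. 414; the print-currency reduction is DESIGN-B3-116-box.md §8.4, not claimed).  No `def … : Prop`, no `sorry`;
axioms standard.  Value = bookkeeping of a located member of a by-reference step of B3 — NOT summit progress and nothing about the Yang–Mills
mass gap.
-/

noncomputable section

namespace Literature.MathematicalPhysics.QuantumFieldTheory.Balaban1983to89.B3Op116CollarConst

open HiggsLattice (ChargeData)
open B1Eq230FluctCov (Ix)
open B3Op116CollarRows (collarC farC faceC collarC_nonneg farC_pos faceC_nonneg)
open B3Ineq31SmoothLocalization (smoothConst smoothConst_pos)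

variable {P : HiggsLattice.Params} {N : ℕ}

/-- **THE EXPLICIT COLLAR CONSTANT `K`** of the one-`V_k` collar members of (2.5) at orders `(1,0)`/`(0,1)` and Hölder exponent `α` — the
constant displayed in `B3Ineq25Op116CollarRegionHolder.ineq25At_one_zero_collar_holder_of_dict` (the bound there is
`C_G + (ε^d)^{−1}·farF(δ,ρ)·collarK`), as a function of: the scale `k`, the rate `δ`, `α`, the perturbation size `s = sup|P|`, its
regularity `δ_A`, the (2.10)/(2.11) dictionary constants of `G_k(Ω,Y)` (`c_Y` value, `c_Y′` derivative, `c_Y″` mixed, `c_Y^H` Hölder) and of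
`G_k(Ω,P+Y)`, the number `n_F` of boundary face slices met by the charged crossing bonds, the bump data `m, c₁, c₂`; through `P`: `d`, `L`,
`ε`, `L^kε`, `a_k`.  [cite: Balaban1983Higgs3, (2.5) p.424, (1.16) p.414, (2.10)-(2.11) p.426, p.433] [cite: Balaban1982Higgs1, Prop. 2.1 p.610] -/
def collarK (P : HiggsLattice.Params) (N : ℕ) (C : ChargeData N) (k : ℕ) (a δ α s δA cY cYd cYm cPY cPYd cPYm cYh cPYh : ℝ)
    (nF m : ℕ) (c₁ c₂ : ℝ) : ℝ :=
  smoothConst P.d m c₁ (c₂ + 2 * c₁) *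
  ((collarC P N k δ 2 1 2 cY cYd cPY (cPYd + Real.exp 1 * cPY * P.mesh k * (|C.e| * s)) (|C.e| * s) 0 ((|C.e| * s) ^ 2) (|C.e| * s) 0
  (|B1.aSeq a P.L k| * (P.mesh k)⁻¹ ^ 2 *
  ((|C.e| * s * P.mesh 0 * (P.d * ((P.L : ℝ) ^ k - 1))) * (2 + |C.e| * s * P.mesh 0 * (P.d * ((P.L : ℝ) ^ k - 1)))))
  + collarC P N k δ 2 1 2 cPY (cPYd + Real.exp 1 * cPY * P.mesh k * (|C.e| * s)) cY cYd (|C.e| * s) 0 ((|C.e| * s) ^ 2) (|C.e| * s) 0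
  (|B1.aSeq a P.L k| * (P.mesh k)⁻¹ ^ 2 *
  ((|C.e| * s * P.mesh 0 * (P.d * ((P.L : ℝ) ^ k - 1))) * (2 + |C.e| * s * P.mesh 0 * (P.d * ((P.L : ℝ) ^ k - 1))))))
  + (collarC P N k δ 1 0 2 cYd cYm cPY (cPYd + Real.exp 1 * cPY * P.mesh k * (|C.e| * s)) (|C.e| * s) 0 ((|C.e| * s) ^ 2) (|C.e| * s) 0
  (|B1.aSeq a P.L k| * (P.mesh k)⁻¹ ^ 2 *
  ((|C.e| * s * P.mesh 0 * (P.d * ((P.L : ℝ) ^ k - 1))) * (2 + |C.e| * s * P.mesh 0 * (P.d * ((P.L : ℝ) ^ k - 1)))))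
  + collarC P N k δ 1 0 2 cPYd (cPYm + Real.exp 1 * cPYd * P.mesh k * ((|C.e| * s) * (Fintype.card (Ix N) : ℝ))) cY cYd (|C.e| * s) 0 ((|C.e| * s) ^ 2) (|C.e| * s) 0
  (|B1.aSeq a P.L k| * (P.mesh k)⁻¹ ^ 2 *
  ((|C.e| * s * P.mesh 0 * (P.d * ((P.L : ℝ) ^ k - 1))) * (2 + |C.e| * s * P.mesh 0 * (P.d * ((P.L : ℝ) ^ k - 1)))))))
  + ((2 * (collarC P N k δ 1 0 2 cYd cYm cPY (cPYd + Real.exp 1 * cPY * P.mesh k * (|C.e| * s)) (|C.e| * s) 0 ((|C.e| * s) ^ 2) (|C.e| * s) 0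
  (|B1.aSeq a P.L k| * (P.mesh k)⁻¹ ^ 2 *
  ((|C.e| * s * P.mesh 0 * (P.d * ((P.L : ℝ) ^ k - 1))) * (2 + |C.e| * s * P.mesh 0 * (P.d * ((P.L : ℝ) ^ k - 1)))))
  + collarC P N k δ 1 0 2 cPYd (cPYm + Real.exp 1 * cPYd * P.mesh k * ((|C.e| * s) * (Fintype.card (Ix N) : ℝ))) cY cYd (|C.e| * s) 0 ((|C.e| * s) ^ 2) (|C.e| * s) 0
  (|B1.aSeq a P.L k| * (P.mesh k)⁻¹ ^ 2 *
  ((|C.e| * s * P.mesh 0 * (P.d * ((P.L : ℝ) ^ k - 1))) * (2 + |C.e| * s * P.mesh 0 * (P.d * ((P.L : ℝ) ^ k - 1))))))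
  + ((2 * collarC P N k δ (1 - α) 0 2 cYh 0 cPY (cPYd + Real.exp 1 * cPY * P.mesh k * (|C.e| * s)) (|C.e| * s) ((P.mesh 0)⁻¹ * (|C.e| * δA)) ((|C.e| * s) ^ 2) 0 0
  (|B1.aSeq a P.L k| * (P.mesh k)⁻¹ ^ 2 *
  ((|C.e| * s * P.mesh 0 * (P.d * ((P.L : ℝ) ^ k - 1))) * (2 + |C.e| * s * P.mesh 0 * (P.d * ((P.L : ℝ) ^ k - 1)))))
  + 2 * ((nF : ℝ) * P.d * (((P.mesh 0)⁻¹ * (|C.e| * δA) + (P.mesh 0)⁻¹ * (|C.e| * s)) + (3 * ((P.mesh 0)⁻¹ * (|C.e| * s)) + 2 * (|C.e| * s) ^ 2)) * (cYh * (farC P δ * cPY) * faceC P (δ / 2))))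
  + (2 * collarC P N k δ (1 - α) 0 2 cPYh 0 cY cYd (|C.e| * s) ((P.mesh 0)⁻¹ * (|C.e| * δA)) ((|C.e| * s) ^ 2) 0 0
  (|B1.aSeq a P.L k| * (P.mesh k)⁻¹ ^ 2 *
  ((|C.e| * s * P.mesh 0 * (P.d * ((P.L : ℝ) ^ k - 1))) * (2 + |C.e| * s * P.mesh 0 * (P.d * ((P.L : ℝ) ^ k - 1)))))
  + 2 * ((nF : ℝ) * P.d * (((P.mesh 0)⁻¹ * (|C.e| * δA) + (P.mesh 0)⁻¹ * (|C.e| * s)) + (3 * ((P.mesh 0)⁻¹ * (|C.e| * s)) + 2 * (|C.e| * s) ^ 2)) * (cPYh * (farC P δ * cY) * faceC P (δ / 2))))))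
  + P.d * m * (collarC P N k δ 1 0 1 cYd cYm ((Fintype.card (Ix N) : ℝ) * cPYd) (cPYm + Real.exp 1 * cPYd * P.mesh k * ((|C.e| * s) * (Fintype.card (Ix N) : ℝ))) (|C.e| * s) 0 ((|C.e| * s) ^ 2) (|C.e| * s) 0
  (|B1.aSeq a P.L k| * (P.mesh k)⁻¹ ^ 2 *
  ((|C.e| * s * P.mesh 0 * (P.d * ((P.L : ℝ) ^ k - 1))) * (2 + |C.e| * s * P.mesh 0 * (P.d * ((P.L : ℝ) ^ k - 1)))))
  + collarC P N k δ 1 0 1 cPYd (cPYm + Real.exp 1 * cPYd * P.mesh k * ((|C.e| * s) * (Fintype.card (Ix N) : ℝ))) ((Fintype.card (Ix N) : ℝ) * cYd) cYm (|C.e| * s) 0 ((|C.e| * s) ^ 2) (|C.e| * s) 0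
  (|B1.aSeq a P.L k| * (P.mesh k)⁻¹ ^ 2 *
  ((|C.e| * s * P.mesh 0 * (P.d * ((P.L : ℝ) ^ k - 1))) * (2 + |C.e| * s * P.mesh 0 * (P.d * ((P.L : ℝ) ^ k - 1)))))))

/-- **`collarK ≥ 0`** for `δ > 0`, `L > 1`, nonnegative dictionary constants, `s, δ_A ≥ 0`, `c₁, c₂ ≥ 0` (every summand is a product of
nonnegative factors: `collarC_nonneg`, `farC_pos`, `faceC_nonneg`, `smoothConst_pos`). [cite: Balaban1983Higgs3, (2.5) p.424, (2.10) p.426] -/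
theorem collarK_nonneg (hL : 1 < P.L) (C : ChargeData N) (k : ℕ) {a δ α s δA cY cYd cYm cPY cPYd cPYm cYh cPYh : ℝ} (hδ : 0 < δ)
    (hs : 0 ≤ s) (hδA : 0 ≤ δA) (hcY : 0 ≤ cY) (hcYd : 0 ≤ cYd) (hcYm : 0 ≤ cYm) (hcPY : 0 ≤ cPY) (hcPYd : 0 ≤ cPYd) (hcPYm : 0 ≤ cPYm)
    (hcYh : 0 ≤ cYh) (hcPYh : 0 ≤ cPYh) (nF m : ℕ) {c₁ c₂ : ℝ} (hc₁ : 0 ≤ c₁) (hc₂ : 0 ≤ c₂) :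
    0 ≤ collarK P N C k a δ α s δA cY cYd cYm cPY cPYd cPYm cYh cPYh nF m c₁ c₂ := by
  have hES : 0 ≤ |C.e| * s := mul_nonneg (abs_nonneg _) hs
  have hNC : 0 ≤ (Fintype.card (Ix N) : ℝ) := Nat.cast_nonneg _
  have hmk : 0 ≤ P.mesh k := (P.mesh_pos k).le
  have hε : 0 ≤ P.mesh 0 := (P.mesh_pos 0).le
  have he1 : 0 ≤ Real.exp 1 := (Real.exp_pos 1).le
  have hd0 : (0 : ℝ) ≤ (P.d : ℝ) := Nat.cast_nonneg _
  have hm' : (0 : ℝ) ≤ (m : ℝ) := Nat.cast_nonneg _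
  have hnF : (0 : ℝ) ≤ (nF : ℝ) := Nat.cast_nonneg _
  have hLk1 : (0 : ℝ) ≤ (P.L : ℝ) ^ k - 1 := by
    have h1 : (1 : ℝ) ≤ (P.L : ℝ) := by exact_mod_cast hL.le
    linarith [one_le_pow₀ (n := k) h1]
  have hm0 : 0 ≤ |C.e| * s * P.mesh 0 * (P.d * ((P.L : ℝ) ^ k - 1)) := mul_nonneg (mul_nonneg hES hε) (mul_nonneg hd0 hLk1)
  have hκ₄0 : 0 ≤ |B1.aSeq a P.L k| * (P.mesh k)⁻¹ ^ 2 *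
      ((|C.e| * s * P.mesh 0 * (P.d * ((P.L : ℝ) ^ k - 1))) * (2 + |C.e| * s * P.mesh 0 * (P.d * ((P.L : ℝ) ^ k - 1)))) :=
    mul_nonneg (mul_nonneg (abs_nonneg _) (pow_nonneg (inv_nonneg.2 hmk) 2)) (mul_nonneg hm0 (by linarith))
  have hκ₂0 : 0 ≤ (P.mesh 0)⁻¹ * (|C.e| * δA) := by positivity
  have hsm : 0 ≤ smoothConst P.d m c₁ (c₂ + 2 * c₁) := (smoothConst_pos P.d m hc₁ (by positivity)).le
  have hfC : 0 ≤ farC P δ := (farC_pos (P := P) hδ).le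
  have hfaceC : 0 ≤ faceC P (δ / 2) := faceC_nonneg (by positivity)
  have hKEX : 0 ≤ (((P.mesh 0)⁻¹ * (|C.e| * δA) + (P.mesh 0)⁻¹ * (|C.e| * s)) + (3 * ((P.mesh 0)⁻¹ * (|C.e| * s)) + 2 * (|C.e| * s) ^ 2)) := by
    positivity
  have h2' : (0 : ℝ) ≤ 2 := by norm_num
  have c1 := collarC_nonneg (N := N) (aK := 2) (aKd := 1) hL k hδ (by norm_num : (0 : ℝ) < 2) hcY hcYd hcPY (by positivity : 0 ≤ cPYd +
    Real.exp 1 * cPY * P.mesh k * (|C.e| * s)) hES le_rfl (pow_nonneg hES 2) hES le_rfl hκ₄0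
  have c2 := collarC_nonneg (N := N) (aK := 2) (aKd := 1) hL k hδ (by norm_num : (0 : ℝ) < 2) hcPY (by positivity : 0 ≤ cPYd +
    Real.exp 1 * cPY * P.mesh k * (|C.e| * s)) hcY hcYd hES le_rfl (pow_nonneg hES 2) hES le_rfl hκ₄0
  have c3 := collarC_nonneg (N := N) (aK := 1) (aKd := 0) hL k hδ (by norm_num : (0 : ℝ) < 2) hcYd hcYm hcPY (by positivity : 0 ≤ cPYd +
    Real.exp 1 * cPY * P.mesh k * (|C.e| * s)) hES le_rfl (pow_nonneg hES 2) hES le_rfl hκ₄0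
  have c4 := collarC_nonneg (N := N) (aK := 1) (aKd := 0) hL k hδ (by norm_num : (0 : ℝ) < 2) hcPYd (by positivity : 0 ≤ cPYm +
    Real.exp 1 * cPYd * P.mesh k * ((|C.e| * s) * (Fintype.card (Ix N) : ℝ))) hcY hcYd hES le_rfl (pow_nonneg hES 2) hES le_rfl hκ₄0
  have c5 := collarC_nonneg (N := N) (aK := 1) (aKd := 0) hL k hδ (by norm_num : (0 : ℝ) < 1) hcYd hcYm (mul_nonneg hNC hcPYd)
    (by positivity : 0 ≤ cPYm + Real.exp 1 * cPYd * P.mesh k * ((|C.e| * s) * (Fintype.card (Ix N) : ℝ))) hES le_rfl (pow_nonneg hES 2)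
    hES le_rfl hκ₄0
  have c6 := collarC_nonneg (N := N) (aK := 1) (aKd := 0) hL k hδ (by norm_num : (0 : ℝ) < 1) hcPYd (by positivity : 0 ≤
    cPYm + Real.exp 1 * cPYd * P.mesh k * ((|C.e| * s) * (Fintype.card (Ix N) : ℝ))) (mul_nonneg hNC hcYd) hcYm hES le_rfl
    (pow_nonneg hES 2) hES le_rfl hκ₄0
  have c7 := collarC_nonneg (N := N) (aK := 1 - α) (aKd := 0) hL k hδ (by norm_num : (0 : ℝ) < 2) hcYh le_rfl hcPY (by positivity : 0 ≤
    cPYd + Real.exp 1 * cPY * P.mesh k * (|C.e| * s)) hES hκ₂0 (pow_nonneg hES 2) le_rfl le_rfl hκ₄0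
  have c8 := collarC_nonneg (N := N) (aK := 1 - α) (aKd := 0) hL k hδ (by norm_num : (0 : ℝ) < 2) hcPYh le_rfl hcY hcYd hES hκ₂0
    (pow_nonneg hES 2) le_rfl le_rfl hκ₄0
  have f10 : 0 ≤ cYh * (farC P δ * cPY) * faceC P (δ / 2) := mul_nonneg (mul_nonneg hcYh (mul_nonneg hfC hcPY)) hfaceC
  have f01 : 0 ≤ cPYh * (farC P δ * cY) * faceC P (δ / 2) := mul_nonneg (mul_nonneg hcPYh (mul_nonneg hfC hcY)) hfaceC
  have hcardK : 0 ≤ (nF : ℝ) * P.d *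
      (((P.mesh 0)⁻¹ * (|C.e| * δA) + (P.mesh 0)⁻¹ * (|C.e| * s)) + (3 * ((P.mesh 0)⁻¹ * (|C.e| * s)) + 2 * (|C.e| * s) ^ 2)) :=
    mul_nonneg (mul_nonneg hnF hd0) hKEX
  unfold collarK
  apply_rules [add_nonneg, mul_nonneg, hsm, h2', hd0, hm', c1, c2, c3, c4, c5, c6, c7, c8, f10, f01, hcardK]

end Literature.MathematicalPhysics.QuantumFieldTheory.Balaban1983to89.B3Op116CollarConst

end
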